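/-
Copyright (c) 2026 the pub-hodgecm-mathlib formalisation cell (harness21).  Prover seat hodgecm-mathlib-K2Liu-p08 (g0), Track B «K2-LIT»,
#184♮ = hLiu418 = `stmt-HodgeConjecture-24832`; K2E5-plan (g5) «GO resGen» 2026-09-04T06:19:43Z (M-156c co-dealer rule, LEAD F0P6-plan (g12);
binder sheet `K2/K2E5-plan/g5/SIGS-RoadI-v3.md` §U0 line `resGen`).  Second DEFS leaf of Road I v3 brick U0; inputs ★ p857843 (`resNorm`),
★ p857866 (U0.1–U0.4).
-/
import Summits.HodgeConjecture.HodgeConjecture.Theorems.K2LiuFirstTermResidueForm   -- ★ U0: `resNorm`, `tendsto_resNorm`, `resNorm_eq_of_continuations`, …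
import HarnessLib

/-!
# Crux `HLiu418`, Road I v3, brick U0 — DEFS leaf 2: the CANONICAL residue form `resGen` of a standard family (the CHOICE wrapper over
# socket #41's `∃ (P, E⋆)`), choice-free by (U0.2)

Cell `hodgecm-mathlib`, crux item hLiu418 = `stmt-HodgeConjecture-24832`; co-dealer K2E5-plan (g5), LEAD F0P6-plan (g12), boxes K2E5-r01 (g6) ∕
K2Liu-ref1 (g2).  ONE DEFINITION WITH BODY (`resGen`) + theorems (no instance, no notation, no named-fact hypothesis, no `sorry`); lane
`--supports stmt-HodgeConjecture-24832 --as helper` (count-neutral; definition ⇒ async audit).  Consumers: U3 `K2LiuResidueMapEquivariant`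
(`resGen` of `ρ(h′)f` vs `resGen f (· h′)`), U1, U5 and the #42F′ closer `firstTermIdentityOnGenerators_of_continuation` (M-156a (R-1′): the closer takes
‹#41› BY VALUE; `resGen (h41 … 𝒦 h𝒦 f hf hfc)` is then the canonical residue form of `f`, and `resGen_eq_resNorm_of_continuation` evaluates it on
#42F′'s ARBITRARY binders `(Pg, Eg)`).

THE OBJECT.  Socket #41 `sig_K2LiuSiegelEisensteinContinuation` (U6 ED. 10 :267), applied at a frame and a standard family `f`, is an EXISTENTIAL
`hex : ∃ (P : Finset ℂ) (E⋆ : ℂ → H(𝔸) → ℂ), (i) ∧ (ii) ∧ (iii) ∧ (iv) ∧ (v)` (holomorphy on `{Re s > 0}`; continuity; left-`H(L⁺)`-invariance;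
`E⋆ = ∏_{p∈P}(s − p)·E^Δ(·; f_s)` on `{Re s > n/2}`; locally uniform moderate growth).  `resGen hex : H(𝔸) → ℂ := resNorm P₀ E⋆₀` for the CHOSEN
witnesses `(P₀, E⋆₀)` (Mathlib `Exists.choose`).  By ★ (U0.2) `resNorm_eq_of_continuations` the value does not depend on the choice: for EVERY pair
`(P, E⋆)` satisfying (i) and (iv) for the same `f`, `resGen hex = resNorm P E⋆` (`resGen_eq_resNorm_of_continuation`); whence `tendsto_resGen`
((U0.1) for any admissible pair), `continuous_resGen`, `resGen_ratH_mul`, `exists_norm_resGen_le` ((U0.3) for the chosen pair), and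
`exists_continuation_resGen` (the chosen pair itself).  The frame `(N, M, n, e, dV, dW)` and `f` are IMPLICIT (read off `hex`); the sheet's
`resGen (hcont : ‹#41›) 𝒦 f hf hfc` is `resGen (hcont 𝒦 h𝒦 f hf hfc)` here (one application; `hcont` = ‹#41› at the frame, e.g.
`sig41 L e dV hdV hdV0 dW hdW hdW0 lam hlam hwt`), so this leaf needs no `IwasawaDatum`∕`IsStandardSectionFamily` binder and serves any character.
[KudlaRallis1994, §1 Thm. 1.1] [Liu2021, App. B Lem. B.10 (2), B.12 pp. 102–104] [Tan1999, §1] [MoeglinWaldspurger1995, IV.1.9–IV.1.11].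
HONEST LABEL.  Count-neutral DEFS leaf; pays nothing by itself; `HC_CM` is proved only modulo the 7 printed citations (2 remaining named inputs:
hLiu418 = `stmt-HodgeConjecture-24832`, h413 = `stmt-HodgeConjecture-24833`) until rung 0 closes.
-/

set_option autoImplicit false
set_option linter.dupNamespace false -- the mandated namespace repeats `HodgeConjecture.HodgeConjecture`
-- statements over the adelic doubled carriers elaborate to very large types; elaborate sequentially (as ★ `K2LiuEisensteinResidueOfGenerators`)
set_option Elab.async false

noncomputable section

open NumberField IsDedekindDomain Filter
open scoped Topology BigOperators

namespace Summit.HodgeConjecture.HodgeConjecture.Cruxes.HLiu418.K2LiuFirstTermResidueGenDefs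

open Literature.NumberTheory.Automorphic
open Literature.NumberTheory.GaloisRepresentations
open Literature.NumberTheory.GelbartRogawski1991 Literature.NumberTheory.GelbartRogawski1991.GRConstruction
open Literature.NumberTheory.K2Lit.SiegelDoubled
open Summit.HodgeConjecture.HodgeConjecture.Cruxes.HLiu418.K2LiuFirstTermResidueFormDefs
open Summit.HodgeConjecture.HodgeConjecture.Cruxes.HLiu418.K2LiuFirstTermResidueForm

section Frame

variable {L : Type} [Field L] [NumberField L] [IsCMField L]
variable {N M n : ℕ} {e : Fin N × Fin M ≃ Fin n}
  {dV : Fin N → L} {hdV : ∀ i, IsCMField.complexConj L (dV i) = dV i}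
  {dW : Fin M → L} {hdW : ∀ i, IsCMField.complexConj L (dW i) = dW i}
  {f : ℂ → HA L e dV hdV dW hdW → ℂ}

/-- **The canonical residue form of a family `f`**: `resNorm P₀ E⋆₀` for the CHOSEN witnesses of socket #41's `∃ (P, E⋆)` for `f` (clauses (i)–(v)
BY VALUE as the hypothesis `hex`).  Choice-free by `resGen_eq_resNorm_of_continuation`. [cite: KudlaRallis1994, §1 Thm. 1.1]
[cite: Liu2021, Lem. B.12 pp. 103–104] [cite: Tan1999, §1] -/
def resGen
    (hex : ∃ (P : Finset ℂ) (Es : ℂ → HA L e dV hdV dW hdW → ℂ),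
      (∀ h : HA L e dV hdV dW hdW, DifferentiableOn ℂ (fun s => Es s h) {s : ℂ | 0 < s.re}) ∧
      (∀ s : ℂ, 0 < s.re → Continuous (Es s)) ∧
      (∀ s : ℂ, 0 < s.re → ∀ (γ : ratH L e dV hdV dW hdW) (h : HA L e dV hdV dW hdW),
        Es s ((γ : HA L e dV hdV dW hdW) * h) = Es s h) ∧
      (∀ (s : ℂ) (h : HA L e dV hdV dW hdW), (n : ℝ) / 2 < s.re →
        Es s h = (∏ p ∈ P, (s - p)) * eisensteinFamilyDelta L e dV hdV dW hdW f s h) ∧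
      (∀ z : ℂ, 0 < z.re → ∃ C A r : ℝ, 0 < r ∧ ∀ s : ℂ, dist s z < r → ∀ h : HA L e dV hdV dW hdW,
        ‖Es s h‖ ≤ C * adelicHeightGL (n + n) L (h : GL (Fin (n + n)) (AdeleRing (𝓞 L) L)) ^ A)) :
    HA L e dV hdV dW hdW → ℂ :=
  resNorm hex.choose hex.choose_spec.choose

variable
  (hex : ∃ (P : Finset ℂ) (Es : ℂ → HA L e dV hdV dW hdW → ℂ),
      (∀ h : HA L e dV hdV dW hdW, DifferentiableOn ℂ (fun s => Es s h) {s : ℂ | 0 < s.re}) ∧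
      (∀ s : ℂ, 0 < s.re → Continuous (Es s)) ∧
      (∀ s : ℂ, 0 < s.re → ∀ (γ : ratH L e dV hdV dW hdW) (h : HA L e dV hdV dW hdW),
        Es s ((γ : HA L e dV hdV dW hdW) * h) = Es s h) ∧
      (∀ (s : ℂ) (h : HA L e dV hdV dW hdW), (n : ℝ) / 2 < s.re →
        Es s h = (∏ p ∈ P, (s - p)) * eisensteinFamilyDelta L e dV hdV dW hdW f s h) ∧
      (∀ z : ℂ, 0 < z.re → ∃ C A r : ℝ, 0 < r ∧ ∀ s : ℂ, dist s z < r → ∀ h : HA L e dV hdV dW hdW,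
        ‖Es s h‖ ≤ C * adelicHeightGL (n + n) L (h : GL (Fin (n + n)) (AdeleRing (𝓞 L) L)) ^ A))

/-- unfolding: `resGen hex` is `resNorm` of the chosen pair. [cite: KudlaRallis1994, §1 Thm. 1.1] -/
theorem resGen_def : resGen hex = resNorm hex.choose hex.choose_spec.choose := rfl

/-- **the chosen pair is a continuation and `resGen` is its residue form** (the witnesses with their five clauses). [cite: Tan1999, §1] -/
theorem exists_continuation_resGen :
    ∃ (P : Finset ℂ) (Es : ℂ → HA L e dV hdV dW hdW → ℂ),
      ((∀ h : HA L e dV hdV dW hdW, DifferentiableOn ℂ (fun s => Es s h) {s : ℂ | 0 < s.re}) ∧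
      (∀ s : ℂ, 0 < s.re → Continuous (Es s)) ∧
      (∀ s : ℂ, 0 < s.re → ∀ (γ : ratH L e dV hdV dW hdW) (h : HA L e dV hdV dW hdW),
        Es s ((γ : HA L e dV hdV dW hdW) * h) = Es s h) ∧
      (∀ (s : ℂ) (h : HA L e dV hdV dW hdW), (n : ℝ) / 2 < s.re →
        Es s h = (∏ p ∈ P, (s - p)) * eisensteinFamilyDelta L e dV hdV dW hdW f s h) ∧
      (∀ z : ℂ, 0 < z.re → ∃ C A r : ℝ, 0 < r ∧ ∀ s : ℂ, dist s z < r → ∀ h : HA L e dV hdV dW hdW,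
        ‖Es s h‖ ≤ C * adelicHeightGL (n + n) L (h : GL (Fin (n + n)) (AdeleRing (𝓞 L) L)) ^ A)) ∧
      resGen hex = resNorm P Es :=
  ⟨hex.choose, hex.choose_spec.choose, hex.choose_spec.choose_spec, rfl⟩

/-- **CHOICE-FREENESS (U0.2 for `resGen`)**: for EVERY pair `(P, E⋆)` satisfying socket #41's clauses (i) and (iv) for `f`, `resGen hex = resNorm P E⋆`
(★ `resNorm_eq_of_continuations`).  This evaluates the canonical residue form on #42F′'s arbitrary `(Pg, Eg)`. [cite: Liu2021, Lem. B.12 pp. 103–104]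
[cite: MoeglinWaldspurger1995, IV.1.9] -/
theorem resGen_eq_resNorm_of_continuation (P : Finset ℂ) (Es : ℂ → HA L e dV hdV dW hdW → ℂ)
    (hd : ∀ h : HA L e dV hdV dW hdW, DifferentiableOn ℂ (fun s => Es s h) {s : ℂ | 0 < s.re})
    (hiv : ∀ (s : ℂ) (h : HA L e dV hdV dW hdW), (n : ℝ) / 2 < s.re →
      Es s h = (∏ p ∈ P, (s - p)) * eisensteinFamilyDelta L e dV hdV dW hdW f s h) :
    resGen hex = resNorm P Es :=
  resNorm_eq_of_continuations L e dV hdV dW hdW f _ _ hex.choose_spec.choose_spec.1 hex.choose_spec.choose_spec.2.2.2.1 P Es hd hiv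

/-- **(U0.1 for `resGen`)** along ANY admissible pair `(P, E⋆)` ((i), (iv)): `(s − ½)·(E⋆(s, h)/∏_P(s − p)) → resGen hex h` on `𝓝[≠] ½`.
[cite: KudlaRallis1994, §1 Thm. 1.1] [cite: Liu2021, Lem. B.12 pp. 103–104] -/
theorem tendsto_resGen (P : Finset ℂ) (Es : ℂ → HA L e dV hdV dW hdW → ℂ)
    (hd : ∀ h : HA L e dV hdV dW hdW, DifferentiableOn ℂ (fun s => Es s h) {s : ℂ | 0 < s.re})
    (hiv : ∀ (s : ℂ) (h : HA L e dV hdV dW hdW), (n : ℝ) / 2 < s.re →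
      Es s h = (∏ p ∈ P, (s - p)) * eisensteinFamilyDelta L e dV hdV dW hdW f s h)
    (h : HA L e dV hdV dW hdW) :
    Tendsto (fun s : ℂ => (s - 1 / 2) * (Es s h / ∏ p ∈ P, (s - p))) (𝓝[≠] (1 / 2)) (𝓝 (resGen hex h)) := by
  rw [resGen_eq_resNorm_of_continuation hex P Es hd hiv]
  exact tendsto_resNorm P Es hd h

/-- the chosen pair's own limit. [cite: KudlaRallis1994, §1 Thm. 1.1] -/
theorem tendsto_resGen_choose (h : HA L e dV hdV dW hdW) :
    Tendsto (fun s : ℂ => (s - 1 / 2) * (hex.choose_spec.choose s h / ∏ p ∈ hex.choose, (s - p))) (𝓝[≠] (1 / 2))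
      (𝓝 (resGen hex h)) :=
  tendsto_resNorm _ _ hex.choose_spec.choose_spec.1 h

/-- **(U0.3a for `resGen`)** the canonical residue form is continuous. [cite: MoeglinWaldspurger1995, IV.1.9–IV.1.11] -/
theorem continuous_resGen : Continuous (resGen hex) :=
  continuous_resNorm L e dV hdV dW hdW _ _ hex.choose_spec.choose_spec.2.1

/-- **(U0.3b for `resGen`)** the canonical residue form is left-`H(L⁺)`-invariant. [cite: MoeglinWaldspurger1995, IV.1.9–IV.1.11] -/
theorem resGen_ratH_mul (γ : ratH L e dV hdV dW hdW) (h : HA L e dV hdV dW hdW) :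
    resGen hex ((γ : HA L e dV hdV dW hdW) * h) = resGen hex h :=
  resNorm_ratH_mul L e dV hdV dW hdW _ _ hex.choose_spec.choose_spec.2.2.1 γ h

/-- **(U0.3c for `resGen`)** the canonical residue form is of moderate growth. [cite: MoeglinWaldspurger1995, IV.1.9–IV.1.11] -/
theorem exists_norm_resGen_le :
    ∃ C A : ℝ, ∀ h : HA L e dV hdV dW hdW,
      ‖resGen hex h‖ ≤ C * adelicHeightGL (n + n) L (h : GL (Fin (n + n)) (AdeleRing (𝓞 L) L)) ^ A :=
  exists_norm_resNorm_le L e dV hdV dW hdW _ _ hex.choose_spec.choose_spec.2.2.2.2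

end Frame

end Summit.HodgeConjecture.HodgeConjecture.Cruxes.HLiu418.K2LiuFirstTermResidueGenDefs

end
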